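import Summits.QuantumFields.BalabanUV.Beta.NVertexSectorsPeriodised
import Summits.QuantumFields.BalabanUV.Beta.FP.PeriodisedBorderTables
import Summits.QuantumFields.BalabanUV.Beta.BubbleParity

/-!
# `BalabanUV.Beta.NVertexParities` — row D1 ∕ (C1), PART 12: **THE (S3-2) N PARITIES OF THE PERIODISED N-VERTEX ARE THEOREMS — the multiplier–multiplier
# entries of `perF T (dper T (VN R P j μ y))` VANISH and its field–multiplier entries are SYMMETRIC; the vertex-family letters of `VN ∕ WN` at a common rate**

WHY (located).  The END wrapper `FP/StepRecursionFeedNestedNamedB.d1Tel_JcComp_ctr_named` (p405971 ✓) DISPLAYS, for the N-system's jets `VN ∕ WN (Roots.ctr Lc) Pn (n+1)`,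
the family letters `hVN : VertexFamily (VN … (n+1)) (NN n) (CvN n) (δN n)`, `hWN : VertexFamily₂ (WN … (n+1)) (NN n) (CwN n) (δN n)` (ONE rate for both) and, per box,
the parities `hVNm : (perF T (dper T (VN … μ y))) (fN a) (fN a') = 0` and `hVNt : (perF T (dper T (VN … μ y))) (b.1, inl b.2) (fN a) = (perF T (dper T (VN … μ y))) (fN a) (b.1, inl b.2)`
for an index map `fN` landing in multiplier fibres (`hmN : ∀ a, ∃ m, (fN a).2 = inr m`) — «exactly what the (C1) dischargers prove» (its header).  PART 10
(`NVertexSectors`) wrote `VN R P j = cE • 𝒲N + cVH • 𝒱bN + cΛ • ℒN`; on every block touching a multiplier leg the Wilson table (lit `wilsonA`, `rfl`) and the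
Λ table (`SLam` over F6a's `compHessFF = packFF …`, `packFF_inr ∕ packFF_inl_inr`) VANISH, so there `VN` IS `cVH •` the border vertex `𝒱bN`, whose table is a
`packVH` (F3 `compVhS`): SYMMETRIC (`packVH_symm`) with NO multiplier–multiplier block (`packVH_inr_inr`).  Under the two period sums (`perF ∘ dper`; road FP's
`PeriodisedBorderTables.perZ_dper_symm` for the symmetric border vertex) this gives THE TWO PARITIES AS THEOREMS for every `R`, `P`, door index `j`, coarse bond
`(μ, y)`, box `M` and every index map into multiplier fibres (§3 **`perF_dper_VN_apply_of_inr_inr`** = `hVNm`'s shape, **`perF_dper_VN_inl_apply_of_inr`** = `hVNt`'s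
shape), and the two family letters at the common blocking `Lc^(j+1)` and ONE common rate (§4 **`vertexFamilies_VN_WN`** = the `hVN ∕ hWN` pair's shape with
`NN n := Lc^(n+2)`).  The instantiation at `R := Roots.ctr Lc`, `P := Pn`, `j := n+1`, `M := towerTorus Lc (fine Lc (Mc B)) (n+1)`, `fN n B` is the road's (no
divisibility of `M` is needed for the parities).

WHAT ([folklore] bookkeeping BY NAME; no `def`, no `def … : Prop`, nothing cited, 0 sorry): §1 pointwise blocks (zero patterns via an2's `BubbleParity.vertexOfK_apply_eq_zero`; lit `wilsonA`'s multiplier rows vanish by `rfl`, inline —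
no same-name restatement, leaf-03 g55 HOLD-2 taken) — `vertexOfK_symm_of_symm`, `compH_inr`, `compH_inl_inr`, `SLam_apply_eq_zero_of_block`, `lamSector_inr`, `lamSector_inl_inr`, `compV_inr_inr`, `compV_symm`, `VbN_symm`,
`VbN_inr_inr`, **`VN_inr`**, **`VN_inl_inr`**, `VN_inr_inr`; §2 periodised — `perF_dper_VN_inr_inr`, `perF_dper_VN_inr`, `perF_dper_VN_inl_inr`,
**`perF_dper_VN_inl_inr_symm`**; §3 the binder shapes — **`perF_dper_VN_apply_of_inr_inr`**, **`perF_dper_VN_inl_apply_of_inr`**, `perF_dper_VN_submatrix_of_inr_inl` (the block `hQN₁` reads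
= `cVH •` the periodised border vertex's); §4 letters — `vertexFamily_VN`,
`vertexFamily₂_WN`, **`vertexFamilies_VN_WN`**.
WHAT THIS IS NOT: not the second-order parities `hWNm ∕ hWNt` (the blocks of `WN = WchartOf … 0` — successor item); not `hHN₁ ∕ hQN₁ ∕ hHN₂ ∕ hQN₂` (the jets
themselves); no other row of the END wrapper discharged, and these four only IN SHAPE (the wrapper's instantiation is the road's); 0 estimates; nothing of Bałaban's
asserted, valued or discharged; 0∕4 row-D1 binders (hW, hR, D1Tel, D1Rep); ROOT M‴ p325680 ∕ P5c ∕ D6 untouched; NOT (C1), NOT (L2′), NOT D1, NEVER «G-an2-4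
closed», NOT BetaPertH, NOT continuum, NOT Clay.

HONEST DEPENDENCY (page 1, mandatory): continuum YM on T⁴ ⇐ BetaPertH ∧ nine spine estimates (0/9 proved); BetaPertH ⇐ (D1) ∧ (D4) ∧ CAP+tail;
G-an2-4 gates asym, D1 and NE2/3/4.  HONEST FRAMING (cell contract, verbatim): «discharging `BetaPertH` makes Bałaban's UV stability UNCONDITIONAL —
a real constructive-QFT result; it is NOT the continuum limit and NOT the Clay problem.»  ABSOLUTE RULE (cell charter, verbatim): «No internally-minted
statement may enter as a cited fact. Every hypothesis is either kernel-proved in this package or a verbatim quotation of a PUBLISHED theorem with page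
reference. The manuscript(s) under audit are NOT citable for their own disputed steps — they are the thing under adjudication; programme-internal
(2001/route/tribunal) claims are never citable.»  Row D1 ∕ (C1) OWNER an2 (b2b-balaban-beta-an2) gen 61, 2026-08-26.  No existing file touched.
-/

noncomputable section

open scoped BigOperators

namespace Summit.QuantumFields.BalabanUV.Beta.NVertexParities

open Finset Matrix
open Literature.MathematicalPhysics.QuantumFieldTheory
open Literature.MathematicalPhysics.QuantumFieldTheory.Balaban1983to89
open Literature.MathematicalPhysics.QuantumFieldTheory.Balaban1983to89.Beta
open B6Lemma24Torus (pbox)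
open ExpKernelCalculus (MKer Decays BiLoc VertexFamily VertexFamily₂)
open AffineAveraging (Site box toSite)
open AveragingHessianKernels (packVH_symm packVH_inr_inr)
open OneStepResolventKernel (Fib KInv LocStencil wsum biLoc_mono)
open OneStepKernelFamily (colH vertexOfK vertexFamily_vertexOfK')
open InterLevelTransport (SLam cwsum_apply)
open StepJetData (wilsonA)
open BalabanStepJets (lamCoeffOf vertexFamily₂_mono)
open Summit.QuantumFields.BalabanUV.Beta.AxialDressingRooted (one_le_of_neZero)
open Summit.QuantumFields.BalabanUV.Beta.ChartStepJets (vertexFamily₂_WchartOf)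
open Summit.QuantumFields.BalabanUV.Beta.CompositeVertexKernelRec (compVhS)
open Summit.QuantumFields.BalabanUV.Beta.CompositeHessianTable (compHessFF packFF_inr packFF_inl_inr)
open Summit.QuantumFields.BalabanUV.Beta.CompositeCorrectorDress (compChart)
open Summit.QuantumFields.BalabanUV.Beta.CompositeOneShotJets (compV compH tabsComp decays_compChart)
open Summit.QuantumFields.BalabanUV.Beta.CompositeOneShotJetData (Roots Pins JNat JNat_W AN VN VN_eq WN WN_eq)
open Summit.QuantumFields.BalabanUV.Beta.FP.KernelPeriodisationFib (Idx perF perF_apply perZ perZ_apply)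
open Summit.QuantumFields.BalabanUV.Beta.FP.KernelPeriodisationFibLoc (dper dper_apply)
open Summit.QuantumFields.BalabanUV.Beta.FP.PeriodisedBorderTables (perZ_dper_symm)
open Summit.QuantumFields.BalabanUV.Beta.BubbleParity (vertexOfK_apply_eq_zero)
open Summit.QuantumFields.BalabanUV.Beta.NVertexSectors (decays_AN VN_eq_sectors)
open Summit.QuantumFields.BalabanUV.Beta.NVertexSectorsPeriodised (locStencil_JNat_S)

/-! ## §1 Pointwise blocks -/

section Blocks

variable {d : ℕ}

/-- [folklore] a family symmetric under `(x, a) ↔ (z, b)` has a symmetric chain-rule vertex. -/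
theorem vertexOfK_symm_of_symm (K : MKer (d + 1) (Fib d)) (N : ℕ) {S : Fin (d + 1) → Site (d + 1) → MKer (d + 1) (Fib d)}
    (hS : ∀ (κ' : Fin (d + 1)) (u x z : Site (d + 1)) (a b : Fib d), S κ' u x z a b = S κ' u z x b a) (μ : Fin (d + 1)) (y x z : Site (d + 1)) (a b : Fib d) :
    vertexOfK K N S μ y x z a b = vertexOfK K N S μ y z x b a := by
  simp only [vertexOfK, wsum, hS]

/-- [folklore] the composite constraint-Hessian table is field–field only: every multiplier row vanishes (F6a `compHessFF = packFF …`, `packFF_inr`). -/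
theorem compH_inr (r : Fin (d + 1) → ℕ) (L n : ℕ) (ν : Fin (d + 1)) (w x z : Site (d + 1)) (m : Fin (d + 1)) (b : Fib d) :
    compH r L n ν w x z (Sum.inr m) b = 0 := by
  simp only [compH, compHessFF, packFF_inr]

/-- [folklore] … and so does the field–multiplier block (`packFF_inl_inr`). -/
theorem compH_inl_inr (r : Fin (d + 1) → ℕ) (L n : ℕ) (ν : Fin (d + 1)) (w x z : Site (d + 1)) (α m : Fin (d + 1)) :
    compH r L n ν w x z (Sum.inl α) (Sum.inr m) = 0 := by
  simp only [compH, compHessFF, packFF_inl_inr]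

/-- [folklore] the abstract Λ-stencil vanishes on a block where all its bricks vanish (`cwsum_apply`). -/
theorem SLam_apply_eq_zero_of_block {N : ℕ} [NeZero N] (c : Fin (d + 1) → Site (d + 1) → Fin (d + 1) → Site (d + 1) → ℝ)
    {Q2 : Fin (d + 1) → Site (d + 1) → MKer (d + 1) (Fib d)} {x z : Site (d + 1)} {a b : Fib d} (hQ : ∀ (ν : Fin (d + 1)) (w : Site (d + 1)), Q2 ν w x z a b = 0)
    (κ' : Fin (d + 1)) (u : Site (d + 1)) : SLam N c Q2 κ' u x z a b = 0 := by
  simp only [SLam, cwsum_apply, hQ, mul_zero, tsum_zero, Finset.sum_const_zero, neg_zero]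

variable {Lc : ℕ} [NeZero Lc] (R : Roots Lc) (P : Pins) (j : ℕ)

/-- [folklore] the Λ-sector table has no multiplier rows. -/
theorem lamSector_inr (κ' : Fin (3 + 1)) (u x z : Site (3 + 1)) (m : Fin (3 + 1)) (b : Fib 3) :
    SLam (Lc ^ (j + 1)) (lamCoeffOf (KInv (N := Lc ^ (j + 1)) (d := 3)) (Lc ^ (j + 1))) (compH R.r Lc (j + 1)) κ' u x z (Sum.inr m) b = 0 :=
  SLam_apply_eq_zero_of_block _ (fun ν w => compH_inr R.r Lc (j + 1) ν w x z m b) κ' u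

/-- [folklore] the Λ-sector table has no field–multiplier block. -/
theorem lamSector_inl_inr (κ' : Fin (3 + 1)) (u x z : Site (3 + 1)) (α m : Fin (3 + 1)) :
    SLam (Lc ^ (j + 1)) (lamCoeffOf (KInv (N := Lc ^ (j + 1)) (d := 3)) (Lc ^ (j + 1))) (compH R.r Lc (j + 1)) κ' u x z (Sum.inl α) (Sum.inr m) = 0 :=
  SLam_apply_eq_zero_of_block _ (fun ν w => compH_inl_inr R.r Lc (j + 1) ν w x z α m) κ' u

omit [NeZero Lc] in
/-- [folklore] the composite border table has no multiplier–multiplier block (F3 `compVhS = packVH …`, `packVH_inr_inr`). -/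
theorem compV_inr_inr (r : Fin (d + 1) → ℕ) (L n : ℕ) (κ' : Fin (d + 1)) (u x z : Site (d + 1)) (m m' : Fin (d + 1)) :
    compV r L n κ' u x z (Sum.inr m) (Sum.inr m') = 0 := by
  simp only [compV, compVhS, packVH_inr_inr]

omit [NeZero Lc] in
/-- [folklore] the composite border table is symmetric under `(x, a) ↔ (z, b)` (`packVH_symm`). -/
theorem compV_symm (r : Fin (d + 1) → ℕ) (L n : ℕ) (κ' : Fin (d + 1)) (u x z : Site (d + 1)) (a b : Fib d) :
    compV r L n κ' u x z a b = compV r L n κ' u z x b a := by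
  simp only [compV, compVhS]
  exact packVH_symm _ _ κ' u x z a b

/-- [folklore] **the border vertex `𝒱bN` is symmetric.** -/
theorem VbN_symm (μ : Fin (3 + 1)) (y x z : Site (3 + 1)) (a b : Fib 3) :
    vertexOfK (AN R j) (Lc ^ (j + 1)) (compV R.r Lc (j + 1)) μ y x z a b = vertexOfK (AN R j) (Lc ^ (j + 1)) (compV R.r Lc (j + 1)) μ y z x b a :=
  vertexOfK_symm_of_symm _ _ (fun κ' u x z a b => compV_symm R.r Lc (j + 1) κ' u x z a b) μ y x z a b

/-- [folklore] the border vertex has no multiplier–multiplier block. -/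
theorem VbN_inr_inr (μ : Fin (3 + 1)) (y x z : Site (3 + 1)) (m m' : Fin (3 + 1)) :
    vertexOfK (AN R j) (Lc ^ (j + 1)) (compV R.r Lc (j + 1)) μ y x z (Sum.inr m) (Sum.inr m') = 0 :=
  vertexOfK_apply_eq_zero (fun κ' u x z => compV_inr_inr R.r Lc (j + 1) κ' u x z m m') μ y x z

/-- [folklore] **`VN_inr` — ON EVERY MULTIPLIER ROW THE N-VERTEX IS `cVH •` THE BORDER VERTEX** (Wilson and Λ sectors vanish there). -/
theorem VN_inr (μ : Fin (3 + 1)) (y x z : Site (3 + 1)) (m : Fin (3 + 1)) (b : Fib 3) :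
    VN R P j μ y x z (Sum.inr m) b = P.cVH (j + 1) * vertexOfK (AN R j) (Lc ^ (j + 1)) (compV R.r Lc (j + 1)) μ y x z (Sum.inr m) b := by
  rw [VN_eq_sectors]
  simp only [Pi.add_apply, Pi.smul_apply, smul_eq_mul,
    vertexOfK_apply_eq_zero (K := AN R j) (N := Lc ^ (j + 1)) (a := Sum.inr m) (b := b)
      (fun (κ' : Fin (3 + 1)) (u x z : Site (3 + 1)) => show wilsonA 3 κ' u x z (Sum.inr m) b = 0 by cases b <;> rfl),
    vertexOfK_apply_eq_zero (K := AN R j) (N := Lc ^ (j + 1)) (fun κ' u x z => lamSector_inr R j κ' u x z m b), mul_zero, zero_add, add_zero]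

/-- [folklore] **`VN_inl_inr` — ON THE FIELD–MULTIPLIER BLOCK THE N-VERTEX IS `cVH •` THE BORDER VERTEX.** -/
theorem VN_inl_inr (μ : Fin (3 + 1)) (y x z : Site (3 + 1)) (α m : Fin (3 + 1)) :
    VN R P j μ y x z (Sum.inl α) (Sum.inr m) =
      P.cVH (j + 1) * vertexOfK (AN R j) (Lc ^ (j + 1)) (compV R.r Lc (j + 1)) μ y x z (Sum.inl α) (Sum.inr m) := by
  rw [VN_eq_sectors]
  simp only [Pi.add_apply, Pi.smul_apply, smul_eq_mul,
    vertexOfK_apply_eq_zero (K := AN R j) (N := Lc ^ (j + 1)) (a := Sum.inl α) (b := Sum.inr m)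
      (fun (κ' : Fin (3 + 1)) (u x z : Site (3 + 1)) => (rfl : wilsonA 3 κ' u x z (Sum.inl α) (Sum.inr m) = 0)),
    vertexOfK_apply_eq_zero (K := AN R j) (N := Lc ^ (j + 1)) (fun κ' u x z => lamSector_inl_inr R j κ' u x z α m), mul_zero, zero_add, add_zero]

/-- [folklore] **`VN_inr_inr` — THE N-VERTEX HAS NO MULTIPLIER–MULTIPLIER BLOCK.** -/
theorem VN_inr_inr (μ : Fin (3 + 1)) (y x z : Site (3 + 1)) (m m' : Fin (3 + 1)) : VN R P j μ y x z (Sum.inr m) (Sum.inr m') = 0 := by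
  rw [VN_inr, VbN_inr_inr, mul_zero]

end Blocks

/-! ## §2 Periodised -/

section Periodised

variable {Lc : ℕ} [NeZero Lc] (R : Roots Lc) (P : Pins) (j : ℕ) (M : Fin (3 + 1) → ℕ)

/-- [folklore] **the periodised N-vertex has no multiplier–multiplier entries.** -/
theorem perF_dper_VN_inr_inr (μ : Fin (3 + 1)) (y : Site (3 + 1)) (p q : ↥(pbox M)) (m m' : Fin (3 + 1)) :
    perF M (dper M (VN R P j μ y)) (p, Sum.inr m) (q, Sum.inr m') = 0 := by
  simp only [perF_apply, perZ_apply, dper_apply, VN_inr_inr, tsum_zero]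

/-- [folklore] multiplier rows of the periodised N-vertex are `cVH •` those of the periodised border vertex. -/
theorem perF_dper_VN_inr (μ : Fin (3 + 1)) (y : Site (3 + 1)) (p q : ↥(pbox M)) (m : Fin (3 + 1)) (b : Fib 3) :
    perF M (dper M (VN R P j μ y)) (p, Sum.inr m) (q, b) =
      P.cVH (j + 1) * perF M (dper M (vertexOfK (AN R j) (Lc ^ (j + 1)) (compV R.r Lc (j + 1)) μ y)) (p, Sum.inr m) (q, b) := by
  simp only [perF_apply, perZ_apply, dper_apply, VN_inr, tsum_mul_left]

/-- [folklore] the field–multiplier entries likewise. -/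
theorem perF_dper_VN_inl_inr (μ : Fin (3 + 1)) (y : Site (3 + 1)) (p q : ↥(pbox M)) (α m : Fin (3 + 1)) :
    perF M (dper M (VN R P j μ y)) (p, Sum.inl α) (q, Sum.inr m) =
      P.cVH (j + 1) * perF M (dper M (vertexOfK (AN R j) (Lc ^ (j + 1)) (compV R.r Lc (j + 1)) μ y)) (p, Sum.inl α) (q, Sum.inr m) := by
  simp only [perF_apply, perZ_apply, dper_apply, VN_inl_inr, tsum_mul_left]

/-- [folklore] **`perF_dper_VN_inl_inr_symm` — THE FIELD–MULTIPLIER ENTRIES OF THE PERIODISED N-VERTEX ARE SYMMETRIC** (the border vertex is symmetric; road FP's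
`PeriodisedBorderTables.perZ_dper_symm` under the two period sums). -/
theorem perF_dper_VN_inl_inr_symm (μ : Fin (3 + 1)) (y : Site (3 + 1)) (p q : ↥(pbox M)) (α m : Fin (3 + 1)) :
    perF M (dper M (VN R P j μ y)) (p, Sum.inl α) (q, Sum.inr m) = perF M (dper M (VN R P j μ y)) (q, Sum.inr m) (p, Sum.inl α) := by
  rw [perF_dper_VN_inl_inr, perF_dper_VN_inr, perF_apply, perF_apply, perZ_dper_symm M (VbN_symm R j μ y)]

end Periodised

/-! ## §3 The binder shapes: an index map landing in multiplier fibres -/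

section Binders

variable {Lc : ℕ} [NeZero Lc] (R : Roots Lc) (P : Pins) (j : ℕ) (M : Fin (3 + 1) → ℕ) {ι : Type*} (f : ι → Idx M (Fib 3))
  (hf : ∀ a : ι, ∃ m : Fin (3 + 1), (f a).2 = Sum.inr m)
include hf

/-- [folklore] **`perF_dper_VN_apply_of_inr_inr` — `hVNm`'s SHAPE: on two indices in multiplier fibres the periodised N-vertex vanishes.** -/
theorem perF_dper_VN_apply_of_inr_inr (μ : Fin (3 + 1)) (y : Site (3 + 1)) (a a' : ι) : perF M (dper M (VN R P j μ y)) (f a) (f a') = 0 := by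
  obtain ⟨m, hm⟩ := hf a
  obtain ⟨m', hm'⟩ := hf a'
  have ha : f a = ((f a).1, Sum.inr m) := Prod.ext rfl hm
  have ha' : f a' = ((f a').1, Sum.inr m') := Prod.ext rfl hm'
  rw [ha, ha']
  exact perF_dper_VN_inr_inr R P j M μ y _ _ m m'

/-- [folklore] **`perF_dper_VN_inl_apply_of_inr` — `hVNt`'s SHAPE: a field index against an index in a multiplier fibre reads the same both ways.** -/
theorem perF_dper_VN_inl_apply_of_inr (μ : Fin (3 + 1)) (y : Site (3 + 1)) (b : ↥(pbox M) × Fin (3 + 1)) (a : ι) :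
    perF M (dper M (VN R P j μ y)) (b.1, Sum.inl b.2) (f a) = perF M (dper M (VN R P j μ y)) (f a) (b.1, Sum.inl b.2) := by
  obtain ⟨m, hm⟩ := hf a
  have ha : f a = ((f a).1, Sum.inr m) := Prod.ext rfl hm
  rw [ha]
  exact perF_dper_VN_inl_inr_symm R P j M μ y b.1 _ b.2 m

/-- [folklore] **THE BLOCK THAT `hQN₁` READS IS `cVH •` THE PERIODISED BORDER VERTEX's**: rows in multiplier fibres against field columns see the border
sector only (`perF_dper_VN_inr` row by row). -/
theorem perF_dper_VN_submatrix_of_inr_inl (μ : Fin (3 + 1)) (y : Site (3 + 1)) :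
    (perF M (dper M (VN R P j μ y))).submatrix f (fun b : ↥(pbox M) × Fin (3 + 1) => ((b.1, Sum.inl b.2) : Idx M (Fib 3))) =
      P.cVH (j + 1) • (perF M (dper M (vertexOfK (AN R j) (Lc ^ (j + 1)) (compV R.r Lc (j + 1)) μ y))).submatrix f
        (fun b : ↥(pbox M) × Fin (3 + 1) => ((b.1, Sum.inl b.2) : Idx M (Fib 3))) := by
  ext a b
  obtain ⟨m, hm⟩ := hf a
  have ha : f a = ((f a).1, Sum.inr m) := Prod.ext rfl hm
  simp only [Matrix.submatrix_apply, Matrix.smul_apply, smul_eq_mul]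
  rw [ha]
  exact perF_dper_VN_inr R P j M μ y _ _ m _

end Binders

/-! ## §4 The vertex-family letters of `VN` and `WN` at a common rate -/

section Letters

variable {Lc : ℕ} [NeZero Lc] (R : Roots Lc) (P : Pins) (j : ℕ)

/-- [folklore] the N-vertex is a vertex family at blocking `Lc^(j+1)` (an4 `vertexFamily_vertexOfK'` with PART 11's `locStencil_JNat_S`). -/
theorem vertexFamily_VN : ∃ Cv δv : ℝ, 0 < δv ∧ VertexFamily (VN R P j) (Lc ^ (j + 1)) Cv δv := by
  obtain ⟨Cs, δs, hδs, hS⟩ := locStencil_JNat_S R P j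
  rw [VN_eq]
  exact vertexFamily_vertexOfK' (N := Lc ^ (j + 1)) (decays_AN R j) hS hδs

/-- [folklore] the N-system's second-order family is a second-order vertex family at blocking `Lc^(j+1)` (F6d-1a `vertexFamily₂_WchartOf … 0` with `decays_compChart`). -/
theorem vertexFamily₂_WN : ∃ Cw δw : ℝ, 0 < δw ∧ VertexFamily₂ (WN R P j) (Lc ^ (j + 1)) Cw δw := by
  rw [WN_eq, JNat_W]
  exact vertexFamily₂_WchartOf (G := fun _ => compChart R.rc Lc (j + 1) (R.s (j + 1)) (Lc ^ (j + 1)))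
    (tabsComp (j + 1) (one_le_of_neZero Lc) R.hr (P.cM (j + 1))) (P.cE (j + 1)) (P.cVH (j + 1)) (P.cΛ (j + 1)) (P.cE₂ (j + 1)) (P.cB (j + 1))
    (P.T (j + 1)) (fun _ => decays_compChart (one_le_of_neZero Lc) R.hrc (j + 1) (R.hs (j + 1))) 0

/-- [folklore] **`vertexFamilies_VN_WN` — THE `hVN ∕ hWN` PAIR's SHAPE: both families at blocking `Lc^(j+1)` and ONE common rate.** -/
theorem vertexFamilies_VN_WN : ∃ Cv Cw δ : ℝ, 0 < δ ∧ VertexFamily (VN R P j) (Lc ^ (j + 1)) Cv δ ∧ VertexFamily₂ (WN R P j) (Lc ^ (j + 1)) Cw δ := by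
  obtain ⟨Cv, δv, hδv, hV⟩ := vertexFamily_VN R P j
  obtain ⟨Cw, δw, hδw, hW⟩ := vertexFamily₂_WN R P j
  have hCv : 0 ≤ Cv := (hV 0 0).nonneg (Sum.inl 0)
  have hCw : 0 ≤ Cw := (hW 0 0 0 0).nonneg (Sum.inl 0)
  exact ⟨Cv, Cw, min δv δw, lt_min hδv hδw, fun μ y => biLoc_mono (hV μ y) hCv (min_le_left _ _),
    vertexFamily₂_mono hW hCw (min_le_right _ _)⟩

end Letters

end Summit.QuantumFields.BalabanUV.Beta.NVertexParities

end
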